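import Summits.BirchSwinnertonDyer.BirchSwinnertonDyer.Theorems.EisensteinDepletionAtTwoStarGO2PrimeSqArith
import HarnessLib

/-!
# The prime-square edge of crux `StarGO2` (item stmt-BirchSwinnertonDyer-24444), arithmetic half:
# the type-I `2`-torsion normal form at an ADDITIVE odd prime `p` forces `p ∈ {7, 17}` or `p ≡ 1 (mod 8)`

Line `star` of crux E1M `DepletedLambdaLawAtTwoMod` (stmt-BirchSwinnertonDyer-20341) is down to the two
research children `StarOptB` (24445) and `StarGO2` (24444). Planner bsd-rank2-p2 GEN 29 isolated the
PRIME-SQUARE EDGE of `StarGO2` (memo `HOME/p2/g29/GO2-via-UBD.md` §8a, file `HOME/p2/g29/PrimeSq.lean`): at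
conductor `N = p²` with `p ≡ ±3 (mod 8)` the depleted Eisenstein ray is ramified, so `StarGO2` there is
EQUIVALENT to «no ÉTALE rational `2`-torsion at conductor `p²`, `p ≡ ±3 (mod 8)`». This file proves the
Diophantine core of that lemma; the curve-side wrapper is
`Theorems/EisensteinDepletionAtTwoStarGO2PrimeSqEtaleTwoTorsion.lean`.

## Content (sub-namespace `PrimeSq`)

An elliptic curve over `ℚ` with a rational point of order `2` is `y² = x³ + Ax² + Bx` with
`B²(A² − 4B) = 2⁸Δ_min`, `A² − 3B = c₄` (tree: `PrimeConductorTwoTorsion.smul_eq_twoTorsionModel`). The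
ÉTALE case at `2` (the point is `2`-integral on the minimal model) is TYPE I: `A ≡ 1 (mod 4)`, `8 ∣ B`.
If the conductor is `p²` (`p` odd) then `Δ_min = ±pⁿ` (`n ≥ 1`) and, the reduction at `p` being ADDITIVE,
`p ∣ c₄ = A² − 3B` — the opposite of Setzer's prime-conductor situation `p ∤ c₄`
(`Literature/NumberTheory/EllipticCurves/PrimeConductorTwoTorsionProofs.lean`; the elementary lemmas are in
`Theorems/EisensteinDepletionAtTwoStarGO2PrimeSqArith.lean`).

* `PrimeSq.typeI_classify` first reduces type I + `p ∣ A² − 3B` to `B = 16B₀`, `B₀²(A² − 64B₀) = ±pⁿ`,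
  `p ∣ A`, `p ∣ B₀` (`p ∤ B₀` would give `B₀ = ±1` and `p ∣ 16`), then calls
* `PrimeSq.core` (strong induction on `n`): `A` odd, `p ∣ A`, `p ∣ B₀`, `B₀²(A² − 64B₀) = ±pⁿ` ⟹
  `p = 7 ∨ p = 17 ∨ p ≡ 1 (mod 8)`. Writing `A = pA₁`, `B₀ = pB₁` gives `B₁²(pA₁² − 64B₁) = ±pⁿ⁻³`;
  if `p ∤ B₁` then `B₁ = ±1` and `pA₁² ∈ {63, 65}`, i.e. `p = 7` (`49a`); if `B₁ = pB₂` then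
  `B₂²(A₁² − 64B₂) = ±pⁿ⁻⁶` and either `p ∤ B₂` (`B₂ = ±1`: `A₁² − 64 = ±pᵉ` gives `p = 17` by
  `(A₁ − 8)(A₁ + 8) = ±pᵉ`; `A₁² + 64 = pᵉ` gives `p = A₁² + 64 ≡ 1 (mod 8)` or `p = 17` by the
  Lebesgue–Nagell equation `sq_add_sixtyfour_eq_prime_pow`), or `p ∣ B₂` and `p ∤ A₁`
  (`A₁² − 64B₂ = ±1`: `(A₁ − 1)(A₁ + 1) = ±64pᵏ` gives `p = 17`; `A₁² + 1 = 64B₂` is impossible mod `4`),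
  or `p ∣ B₂`, `p ∣ A₁` — the induction hypothesis.
* `PrimeSq.typeI_classify`, `PrimeSq.typeI_false`: the package consumed by the curve-side file
  (`p ≡ 3, 5 (mod 8)` is contradictory).

HONEST FRAMING: elementary arithmetic toward ONE edge of an OPEN crux (`StarGO2`, generalized Ogg at the
prime `2`); neither `StarGO2` nor E1M is proved here; nothing reads an analytic rank; BSD is not proved
by any of this.

References: [Setzer1975] B. Setzer, *Elliptic curves of prime conductor*, J. London Math. Soc. (2) 10
(1975) 367–378, §2 (the normal form `y² = x³ + Ax² + Bx`); [SilvermanAEC2009] J. H. Silverman, *The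
Arithmetic of Elliptic Curves*, 2nd ed., VII.5.1 (additive reduction: `v(c₄) > 0`, `v(Δ) > 0`);
[Cohn1993] J. H. E. Cohn, *The Diophantine equation x² + C = yⁿ*, Acta Arith. 65 (1993) (the case `C = 64`,
tree `LebesgueNagellSixtyFour.lean`).
-/

set_option linter.dupNamespace false
set_option autoImplicit false

namespace Summit.BirchSwinnertonDyer.BirchSwinnertonDyer.Theorems.DepletionAtTwo

namespace PrimeSq

/-! ## §2 The core: `A` odd, `p ∣ A`, `p ∣ B₀`, `B₀²(A² − 64B₀) = ±pⁿ` -/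

/-- **Core of the prime-square edge** (strong induction on `n`). For an odd prime `p`, an odd `A`
with `p ∣ A`, and `B` with `p ∣ B` and `B²(A² − 64B) = ±pⁿ`, one has `p = 7`, `p = 17` or
`p ≡ 1 (mod 8)` (the three exits are `pA₁² = 63` at `p = 7`, the equations `(A₁ ∓ 8)(A₁ ± 8) = ±pᵉ` /
`(A₁ − 1)(A₁ + 1) = ±64pᵏ` at `p = 17`, and the Lebesgue–Nagell equation `A₁² + 64 = pᵉ`).
[cite: Setzer1975, §2 (the same descent for prime conductor); Cohn1993 (x² + 64 = yⁿ)] -/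
theorem core {p : ℕ} (hp : p.Prime) (hp2 : p ≠ 2) (n : ℕ) :
    ∀ (A B : ℤ), Odd A → (p : ℤ) ∣ A → (p : ℤ) ∣ B →
      (B ^ 2 * (A ^ 2 - 64 * B) = (p : ℤ) ^ n ∨ B ^ 2 * (A ^ 2 - 64 * B) = -((p : ℤ) ^ n)) →
      p = 7 ∨ p = 17 ∨ p % 8 = 1 := by
  induction n using Nat.strong_induction_on with
  | _ n ih =>
  intro A B hA hpA hpB hE
  have hp' : Prime (p : ℤ) := Nat.prime_iff_prime_int.mp hp
  have hppos : (0 : ℤ) < p := by exact_mod_cast hp.pos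
  have hp3 : (3 : ℤ) ≤ p := by have := hp.two_le; omega
  obtain ⟨A₁, rfl⟩ := hpA
  obtain ⟨B₁, rfl⟩ := hpB
  have hA₁ : Odd A₁ := (Int.odd_mul.mp hA).2
  -- `p³ · B₁²(pA₁² − 64B₁) = ±pⁿ`
  have hX : (p : ℤ) ^ 3 * (B₁ ^ 2 * (p * A₁ ^ 2 - 64 * B₁)) = (p : ℤ) ^ n ∨
      (p : ℤ) ^ 3 * (B₁ ^ 2 * (p * A₁ ^ 2 - 64 * B₁)) = -((p : ℤ) ^ n) := by
    rcases hE with h | h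
    · left; linear_combination h
    · right; linear_combination h
  obtain ⟨n₁, hn₁, hE₁⟩ := of_pow_three_mul hp hX
  by_cases hpB₁ : (p : ℤ) ∣ B₁
  · obtain ⟨B₂, rfl⟩ := hpB₁
    -- `p³ · B₂²(A₁² − 64B₂) = ±pⁿ¹`
    have hY : (p : ℤ) ^ 3 * (B₂ ^ 2 * (A₁ ^ 2 - 64 * B₂)) = (p : ℤ) ^ n₁ ∨
        (p : ℤ) ^ 3 * (B₂ ^ 2 * (A₁ ^ 2 - 64 * B₂)) = -((p : ℤ) ^ n₁) := by
      rcases hE₁ with h | h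
      · left; linear_combination h
      · right; linear_combination h
    obtain ⟨n₂, hn₂, hE₂⟩ := of_pow_three_mul hp hY
    by_cases hpB₂ : (p : ℤ) ∣ B₂
    · by_cases hpA₁ : (p : ℤ) ∣ A₁
      · -- descent
        exact ih n₂ (by omega) A₁ B₂ hA₁ hpA₁ hpB₂ hE₂
      · -- `p ∤ A₁² − 64B₂`, so `A₁² − 64B₂ = ±1`
        have hnd : ¬ (p : ℤ) ∣ A₁ ^ 2 - 64 * B₂ := by
          intro h
          have h64 : (p : ℤ) ∣ 64 * B₂ := dvd_mul_of_dvd_right hpB₂ 64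
          have hA2 : (p : ℤ) ∣ A₁ ^ 2 := by
            have := dvd_add h h64
            rwa [sub_add_cancel] at this
          exact hpA₁ (hp'.dvd_of_dvd_pow hA2)
        have h1 := eq_one_or_neg_one_of_mul_eq hp' hnd (c := B₂ ^ 2) (m := n₂) (by
          rcases hE₂ with h | h
          · left; linear_combination h
          · right; linear_combination h)
        rcases h1 with h1 | h1
        · -- `A₁² − 64B₂ = 1`: `B₂² = pⁿ²`, `B₂ = ±pᵏ`, `(A₁ − 1)(A₁ + 1) = ±64pᵏ` ⟹ `p = 17`
          have hsq : B₂ ^ 2 = (p : ℤ) ^ n₂ := by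
            rcases hE₂ with h | h
            · rw [h1, mul_one] at h; exact h
            · rw [h1, mul_one] at h
              nlinarith [sq_nonneg B₂, pow_pos hppos n₂]
          have hB₂d : B₂ ∣ (p : ℤ) ^ n₂ := ⟨B₂, by rw [← hsq]; ring⟩
          obtain ⟨k, hk⟩ := eq_pow_or_neg_pow_of_dvd hp hB₂d
          have h17 := sq_sub_one hp hp2 (A := A₁) (l := k) (by
            rcases hk with hk | hk
            · left; linear_combination h1 + 64 * hk
            · right; linear_combination h1 + 64 * hk)
          exact Or.inr (Or.inl h17.1)
        · -- `A₁² − 64B₂ = −1` is impossible modulo `4`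
          exfalso
          have h4 : A₁ ^ 2 % 4 = 1 := Int.sq_mod_four_eq_one_of_odd hA₁
          generalize A₁ ^ 2 = s at h1 h4
          omega
    · -- `p ∤ B₂`: `B₂ = ±1`
      have h1 := eq_one_or_neg_one_of_mul_eq hp' hpB₂ (c := B₂ * (A₁ ^ 2 - 64 * B₂)) (m := n₂) (by
        rcases hE₂ with h | h
        · left; linear_combination h
        · right; linear_combination h)
      rcases Nat.eq_zero_or_pos n₂ with hn0 | hn0
      · -- `n₂ = 0`: `A₁² = 64B₂ ± 1 ∈ {±63, ±65}`, not a square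
        exfalso
        subst hn0
        simp only [pow_zero] at hE₂
        apply sq_ne_sixtyfour_pm_one (A := A₁)
        rcases h1 with rfl | rfl <;> rcases hE₂ with h | h
        · right; left; linear_combination h
        · left; linear_combination h
        · right; right; left; linear_combination h
        · right; right; right; linear_combination h
      · rcases h1 with rfl | rfl
        · -- `B₂ = 1`: `(A₁ − 8)(A₁ + 8) = A₁² − 64 = ±pⁿ²` ⟹ `p = 17`
          have h17 := sq_sub_sixtyfour hp hp2 (A := A₁) (l := n₂) (by
            rcases hE₂ with h | h
            · left; linear_combination h
            · right; linear_combination h)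
          exact Or.inr (Or.inl h17.1)
        · -- `B₂ = −1`: `A₁² + 64 = pⁿ²` — the Lebesgue–Nagell equation
          have hLN : A₁ ^ 2 + 64 = (p : ℤ) ^ n₂ := by
            rcases hE₂ with h | h
            · linear_combination h
            · nlinarith [sq_nonneg A₁, pow_pos hppos n₂]
          rcases Literature.NumberTheory.DiophantineGeometry.sq_add_sixtyfour_eq_prime_pow hp hp2 n₂ A₁
              hLN with hn1 | ⟨-, h17⟩
          · -- `n₂ = 1`: `p = A₁² + 64 ≡ 1 (mod 8)`
            subst hn1
            right; right
            have h8 := sq_emod_eight_of_odd hA₁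
            rw [pow_one] at hLN
            generalize A₁ ^ 2 = s at hLN h8
            omega
          · exact Or.inr (Or.inl h17)
  · -- `p ∤ B₁`: `B₁ = ±1`
    have h1 := eq_one_or_neg_one_of_mul_eq hp' hpB₁ (c := B₁ * (p * A₁ ^ 2 - 64 * B₁)) (m := n₁) (by
      rcases hE₁ with h | h
      · left; linear_combination h
      · right; linear_combination h)
    have hB₁sq : B₁ ^ 2 = 1 := by rcases h1 with rfl | rfl <;> norm_num
    rcases Nat.eq_zero_or_pos n₁ with hn0 | hn0
    · -- `n₁ = 0`: `pA₁² = 64B₁ ± 1 ∈ {63, 65}` (positivity), hence `p = 7`, `A₁ = ±3`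
      subst hn0
      simp only [pow_zero] at hE₁
      left
      have hA₁0 : A₁ ≠ 0 := by rintro rfl; exact absurd hA₁ (by decide)
      have hsqpos : 0 < A₁ ^ 2 := by positivity
      have hpos : 0 < (p : ℤ) * A₁ ^ 2 := mul_pos hppos hsqpos
      have key : (p : ℤ) * A₁ ^ 2 = 63 ∨ (p : ℤ) * A₁ ^ 2 = 65 := by
        rcases h1 with rfl | rfl <;> rcases hE₁ with h | h
        · right; linear_combination h
        · left; linear_combination h
        · exfalso; nlinarith [h]
        · exfalso; nlinarith [h]
      have hsq65 : A₁ ^ 2 ≤ 65 := by rcases key with k | k <;> nlinarith [sq_nonneg A₁]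
      have hb1 : A₁ ≤ 9 := by nlinarith [sq_nonneg A₁]
      have hb2 : -9 ≤ A₁ := by nlinarith [sq_nonneg A₁]
      interval_cases A₁ <;> rcases key with k | k <;> norm_num at k <;>
        first
        | omega
        | (exfalso
           have h63 : p = 63 := by omega
           subst h63; exact absurd hp (by norm_num))
        | (exfalso
           have h65 : p = 65 := by omega
           subst h65; exact absurd hp (by norm_num))
    · -- `n₁ ≥ 1`: `p ∣ pA₁² − 64B₁ = ±pⁿ¹`, so `p ∣ 64`, absurd
      exfalso
      have hd : (p : ℤ) ∣ p * A₁ ^ 2 - 64 * B₁ := by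
        have hn1 : n₁ ≠ 0 := by omega
        rcases hE₁ with h | h
        · rw [hB₁sq, one_mul] at h; rw [h]; exact dvd_pow_self _ hn1
        · rw [hB₁sq, one_mul] at h; rw [h]; exact (dvd_pow_self _ hn1).neg_right
      have h64 : (p : ℤ) ∣ 64 * B₁ := by
        have := dvd_sub (dvd_mul_right (p : ℤ) (A₁ ^ 2)) hd
        rwa [sub_sub_cancel] at this
      have h64' : (p : ℤ) ∣ 64 := (hp'.dvd_or_dvd h64).resolve_right hpB₁
      have h2 : p ∣ 2 ^ 6 := by exact_mod_cast h64'
      exact hp2 ((Nat.prime_dvd_prime_iff_eq hp Nat.prime_two).mp (hp.dvd_of_dvd_pow h2))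

/-! ## §3 The type-I package at an additive odd prime -/

/-- **Type I at an additive odd prime, classification.** If `B²(A² − 4B) = ±2⁸pⁿ` (`n ≥ 1`, `p` an odd
prime), `p ∣ A² − 3B` (additive reduction: `p ∣ c₄`), `A ≡ 1 (mod 4)` and `8 ∣ B` (type I: the
`2`-torsion point is étale at `2`), then `p = 7`, `p = 17` or `p ≡ 1 (mod 8)`. First `B = 16B₀` by
parity, `B₀²(A² − 64B₀) = ±pⁿ`, `p ∣ A² − 48B₀`; `p ∤ B₀` would give `B₀ = ±1` and `p ∣ 16`; so
`p ∣ B₀`, `p ∣ A`, and `core` applies. [cite: Setzer1975, §2 (normal form; here with `p ∣ c₄` instead of `p ∤ c₄`)] -/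
theorem typeI_classify {p : ℕ} (hp : p.Prime) (hp2 : p ≠ 2) {A B : ℤ} {n : ℕ} (hn : 1 ≤ n)
    (hD : B ^ 2 * (A ^ 2 - 4 * B) = 2 ^ 8 * (p : ℤ) ^ n ∨
      B ^ 2 * (A ^ 2 - 4 * B) = -(2 ^ 8 * (p : ℤ) ^ n))
    (hC : (p : ℤ) ∣ A ^ 2 - 3 * B) (hA : A % 4 = 1) (hB : (8 : ℤ) ∣ B) :
    p = 7 ∨ p = 17 ∨ p % 8 = 1 := by
  have hp' : Prime (p : ℤ) := Nat.prime_iff_prime_int.mp hp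
  have hAodd : Odd A := Int.odd_iff.mpr (by omega)
  obtain ⟨B', rfl⟩ := hB
  -- `B'` is even (adapted from `PrimeConductorTwoTorsion.classify_typeI`)
  have hE : B' ^ 2 * (A ^ 2 - 32 * B') = 4 * (p : ℤ) ^ n ∨
      B' ^ 2 * (A ^ 2 - 32 * B') = -(4 * (p : ℤ) ^ n) := by
    rcases hD with h | h
    · left; exact mul_left_cancel₀ (by norm_num : (64 : ℤ) ≠ 0) (by linear_combination h)
    · right; exact mul_left_cancel₀ (by norm_num : (64 : ℤ) ≠ 0) (by linear_combination h)
  have hB'even : Even B' := by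
    by_contra hodd
    rw [Int.not_even_iff_odd] at hodd
    have h1 : Odd (B' ^ 2 * (A ^ 2 - 32 * B')) :=
      hodd.pow.mul (hAodd.pow.sub_even ⟨16 * B', by ring⟩)
    have h2 : Even (B' ^ 2 * (A ^ 2 - 32 * B')) := by
      rcases hE with h | h <;> rw [h]
      · exact ⟨2 * (p : ℤ) ^ n, by ring⟩
      · exact ⟨-(2 * (p : ℤ) ^ n), by ring⟩
    exact Int.not_even_iff_odd.mpr h1 h2
  obtain ⟨B₀, hB₀⟩ := hB'even
  -- `B₀²(A² − 64B₀) = ±pⁿ` and `p ∣ A² − 48B₀`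
  have hE1 : B₀ ^ 2 * (A ^ 2 - 64 * B₀) = (p : ℤ) ^ n ∨
      B₀ ^ 2 * (A ^ 2 - 64 * B₀) = -((p : ℤ) ^ n) := by
    rcases hE with h | h <;> rw [hB₀] at h
    · left; exact mul_left_cancel₀ (by norm_num : (4 : ℤ) ≠ 0) (by linear_combination h)
    · right; exact mul_left_cancel₀ (by norm_num : (4 : ℤ) ≠ 0) (by linear_combination h)
  have hC' : (p : ℤ) ∣ A ^ 2 - 48 * B₀ := by
    have : A ^ 2 - 3 * (8 * B') = A ^ 2 - 48 * B₀ := by rw [hB₀]; ring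
    rwa [this] at hC
  by_cases hpB₀ : (p : ℤ) ∣ B₀
  · -- `p ∣ B₀`, hence `p ∣ A² `, `p ∣ A`: the core
    have hpA : (p : ℤ) ∣ A := by
      have h48 : (p : ℤ) ∣ 48 * B₀ := dvd_mul_of_dvd_right hpB₀ 48
      have hA2 : (p : ℤ) ∣ A ^ 2 := by
        have := dvd_add hC' h48
        rwa [sub_add_cancel] at this
      exact hp'.dvd_of_dvd_pow hA2
    exact core hp hp2 n A B₀ hAodd hpA hpB₀ hE1
  · -- `p ∤ B₀`: `B₀ = ±1`, `A² − 64B₀ = ±pⁿ` is divisible by `p`, and so is `16B₀` — absurd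
    exfalso
    have h1 := eq_one_or_neg_one_of_mul_eq hp' hpB₀ (c := B₀ * (A ^ 2 - 64 * B₀)) (m := n) (by
      rcases hE1 with h | h
      · left; linear_combination h
      · right; linear_combination h)
    have hB₀sq : B₀ ^ 2 = 1 := by rcases h1 with rfl | rfl <;> norm_num
    have hn0 : n ≠ 0 := by omega
    have hd : (p : ℤ) ∣ A ^ 2 - 64 * B₀ := by
      rcases hE1 with h | h
      · rw [hB₀sq, one_mul] at h; rw [h]; exact dvd_pow_self _ hn0
      · rw [hB₀sq, one_mul] at h; rw [h]; exact (dvd_pow_self _ hn0).neg_right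
    have h16 : (p : ℤ) ∣ 16 * B₀ := by
      have := dvd_sub hC' hd
      have e : A ^ 2 - 48 * B₀ - (A ^ 2 - 64 * B₀) = 16 * B₀ := by ring
      rwa [e] at this
    have h16' : (p : ℤ) ∣ 16 := (hp'.dvd_or_dvd h16).resolve_right hpB₀
    have h2 : p ∣ 2 ^ 4 := by exact_mod_cast h16'
    exact hp2 ((Nat.prime_dvd_prime_iff_eq hp Nat.prime_two).mp (hp.dvd_of_dvd_pow h2))

/-- **Type I is impossible at an additive prime `p ≡ ±3 (mod 8)`** — the arithmetic heart of the
prime-square edge of `StarGO2`: with the hypotheses of `typeI_classify` and `p % 8 ∈ {3, 5}` one gets a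
contradiction (`7 ≡ 7`, `17 ≡ 1`). [cite: Setzer1975, §2 (normal form); elementary] -/
theorem typeI_false {p : ℕ} (hp : p.Prime) (hp8 : p % 8 = 3 ∨ p % 8 = 5) {A B : ℤ} {n : ℕ}
    (hn : 1 ≤ n)
    (hD : B ^ 2 * (A ^ 2 - 4 * B) = 2 ^ 8 * (p : ℤ) ^ n ∨
      B ^ 2 * (A ^ 2 - 4 * B) = -(2 ^ 8 * (p : ℤ) ^ n))
    (hC : (p : ℤ) ∣ A ^ 2 - 3 * B) (hA : A % 4 = 1) (hB : (8 : ℤ) ∣ B) : False := by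
  have hp2 : p ≠ 2 := by omega
  rcases typeI_classify hp hp2 hn hD hC hA hB with h | h | h <;> omega

end PrimeSq

end Summit.BirchSwinnertonDyer.BirchSwinnertonDyer.Theorems.DepletionAtTwo
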